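import Summits.QuantumFields.YangMills.Theses.ThermalTraceWindow
import Summits.QuantumFields.YangMills.Theorems.SwapTwistDeficitSheetTrialEstimates
import HarnessLib

/-!
# BC5 rung of `ThermalTraceWindow.SubFemtoFirstLevel` (K2a, item stmt-QuantumFields-28291) at EVERY FIXED LATTICE SIZE — PROVED

K2a of route `ThermalTraceWindow` (LINE g8-B of seat ym-idea-4; also the target of the g10 trace-door routes `SlowBitWindow` and
`SwapTwistDeficit`) asks, uniformly in the sub-femto window `L₀ ≤ L ≤ β^A`, that the first zero-flux transfer level is not split off:
`β^{-k} λ₀(β,L)^L ≤ λ₁(β,L)^L`.  The tree held the `L = 1` instance (`subFemtoFirstLevel_rung_one`, via the crux `OneSiteLevels`).  This file proves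
the instance at EVERY FIXED `L ≥ 1`:

* ★ `subFemtoFirstLevel_rung_fixedL : ∀ L, ∃ k β₀, ∀ β ≥ β₀, β^{-k} λ₀(β,L)^L ≤ λ₁(β,L)^L`

— so at no fixed lattice size is the first zero-flux level split off by a `β`-independent (indeed by more than a `β`-power) amount: the failure
mode «β-independent splitting at fixed `L`» of the K2a instrument row is excluded for every `L`.  What K2a proper adds is UNIFORMITY of
`(k, β₀)` along the window `L ≤ β^A` (the renormalisation-group content); here `k = k_L` grows like `L⁴` and `β₀ = β₀(L)`.

MECHANISM (min–max with a swap pair, [cite: ReedSimonIV1978, Thm. XIII.1]): with the sheet trial function `g` of `…SwapTwistDeficitFlatSheetDefs`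
(localised near the flat sheet configuration, `x`-holonomy `diag(i,−i)`) and its axis swap `g∘S`, the plane `{a·g + b·g∘S}` consists of physical
zero-flux test functions with `‖a g + b g∘S‖² = (a²+b²)‖g‖²` (disjoint supports) and `q_β(a g + b g∘S) = (a²+b²) q_β(g,g) + 2ab q_β(g,g∘S) ≥
(a²+b²)(q_β(g,g) − q_β(g,g∘S))`; every physical constraint `φ` is orthogonal to a non-zero element of the plane, so
`λ₁ ≥ q_β(g,g) − q_β(g,g∘S) ≥ β^{−k} c_β^{|E|}` (`sheetTrial_gap`: box Laplace bound near the sheet, exponential suppression across the swap)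
`≥ β^{−k} λ₀` (`topValue_le_latCE`).

HONEST FRAMING: a finite-dimensional (`SU(2)^{3L³}`) variational inequality at each fixed `L` — the witness-of-weakness rung (D-0033 T3) of K2a at
every lattice size, exercising the line's lever (two populated zero-flux levels); NOT K2a (no uniformity in `L`), no RG, nothing about infinite
volume or the continuum; R2ξ″ and the Clay Yang–Mills gap are untouched.  No `sorry`, no new axiom, no new definition.
-/

noncomputable section

open MeasureTheory Filter Topology Real
open Literature.MathematicalPhysics.QuantumLattice
open Literature.MathematicalPhysics.QuantumFieldTheory hiding SU2
open Summit.QuantumFields.YangMills.Theorems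
open Summit.QuantumFields.YangMills.Theorems.FemtoTransferGap
open Summit.QuantumFields.YangMills.Theorems.FemtoTransferGap.FlatSheet

namespace Summit.QuantumFields.YangMills.Theses.ThermalTraceWindow

/-- **The swap pair bounds the second transfer value from below**: for every `L ≥ 1` there are `k, β₁` with `β^{−k} · c_β^{|E|} ≤ λ₁(β, L)` for
`β ≥ β₁` (min–max on the plane spanned by the sheet trial function and its axis swap). [cite: ReedSimonIV1978, Thm. XIII.1] -/
theorem rpow_mul_latCE_le_levelValue_one (L : ℕ) [NeZero L] :
    ∃ k β₁ : ℝ, 1 ≤ β₁ ∧ ∀ β : ℝ, β₁ ≤ β → β ^ (-k) * latCE L β ≤ levelValue su2Rep L β 1 := by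
  obtain ⟨k, β₁, hβ₁, hgap⟩ := sheetTrial_gap L
  refine ⟨k, β₁, hβ₁, fun β hβ => ?_⟩
  have hβ0 : 0 < β := by linarith
  -- the two trial functions and their pairings
  set g : GaugeConfig 3 L FemtoTransferGap.SU2 → ℝ := sheetTrial with hg
  set gS : GaugeConfig 3 L FemtoTransferGap.SU2 → ℝ := fun U => sheetTrial (configPerm (Equiv.swap (0 : Fin 3) 1) U) with hgS
  have hgP : IsPhys g := isPhys_sheetTrial
  have hgSP : IsPhys gS := isPhys_sheetTrial.comp_configPerm (Equiv.swap (0 : Fin 3) 1)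
  set n : ℝ := l2 g g with hn
  set Q : ℝ := qform su2Rep β g g with hQ
  set X : ℝ := qform su2Rep β g gS with hX
  set s : ℝ := β ^ (-k) * latCE L β with hs
  have hn0 : 0 < n := l2_sheetTrial_pos
  have hn1 : n ≤ 1 := l2_sheetTrial_le_one
  have hX0 : 0 ≤ X := qform_sheetTrial_cross_nonneg β
  have hsQX : s ≤ Q - X := hgap β hβ
  have hs0 : 0 ≤ s := mul_nonneg (Real.rpow_nonneg hβ0.le _) (latCE_pos hβ0.le).le
  have hnS : l2 gS gS = n := l2_sheetTrial_swap
  have hcross : l2 g gS = 0 := l2_sheetTrial_cross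
  have hcross' : l2 gS g = 0 := by rw [l2_comm, hcross]
  have hQS : qform su2Rep β gS gS = Q := qform_sheetTrial_swap_swap β
  have hXS : qform su2Rep β gS g = X := qform_sheetTrial_swap_comm β
  -- the trial plane `a·g + b·gS`
  have hphys : ∀ a b : ℝ, IsPhys (a • g + b • gS) := fun a b => (hgP.smul a).add (hgSP.smul b)
  have hl2φ : ∀ (a b : ℝ) {φ : GaugeConfig 3 L FemtoTransferGap.SU2 → ℝ}, IsPhys φ →
      l2 (a • g + b • gS) φ = a * l2 g φ + b * l2 gS φ := fun a b φ hφ => by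
    rw [l2_add_left (hgP.smul a) (hgSP.smul b) hφ, l2_smul_left, l2_smul_left]
  have hl2 : ∀ a b : ℝ, l2 (a • g + b • gS) (a • g + b • gS) = (a ^ 2 + b ^ 2) * n := fun a b => by
    rw [hl2φ a b (hphys a b), l2_comm g, l2_comm gS, hl2φ a b hgP, hl2φ a b hgSP, hnS, hcross, hcross']
    ring
  have hq : ∀ a b : ℝ, qform su2Rep β (a • g + b • gS) (a • g + b • gS) = (a ^ 2 + b ^ 2) * Q + 2 * a * b * X := fun a b => by
    rw [qform_add_left β (hgP.smul a) (hgSP.smul b) (hphys a b), qform_smul_left, qform_smul_left,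
      qform_su2Rep_comm β hgP (hphys a b), qform_su2Rep_comm β hgSP (hphys a b),
      qform_add_left β (hgP.smul a) (hgSP.smul b) hgP, qform_add_left β (hgP.smul a) (hgSP.smul b) hgSP,
      qform_smul_left, qform_smul_left, qform_smul_left, qform_smul_left, hQS, hXS, ← hQ, ← hX]
    ring
  -- Rayleigh bound on the plane: `s ‖ψ‖² ≤ q_β(ψ, ψ)`
  have hray : ∀ a b : ℝ, s * l2 (a • g + b • gS) (a • g + b • gS) ≤ qform su2Rep β (a • g + b • gS) (a • g + b • gS) := by
    intro a b
    rw [hl2, hq]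
    have h1 : s * ((a ^ 2 + b ^ 2) * n) ≤ (Q - X) * (a ^ 2 + b ^ 2) := by
      calc s * ((a ^ 2 + b ^ 2) * n) ≤ s * ((a ^ 2 + b ^ 2) * 1) :=
            mul_le_mul_of_nonneg_left (mul_le_mul_of_nonneg_left hn1 (by positivity)) hs0
        _ = s * (a ^ 2 + b ^ 2) := by ring
        _ ≤ (Q - X) * (a ^ 2 + b ^ 2) := mul_le_mul_of_nonneg_right hsQX (by positivity)
    have h2 : (Q - X) * (a ^ 2 + b ^ 2) ≤ (a ^ 2 + b ^ 2) * Q + 2 * a * b * X := by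
      nlinarith [mul_nonneg (sq_nonneg (a + b)) hX0]
    exact h1.trans h2
  -- min–max: every physical constraint is orthogonal to a non-zero element of the plane
  rw [levelValue_one]
  unfold secondValue
  refine le_csInf ⟨_, ⟨fun _ => 1, isPhys_const 1, rfl⟩⟩ ?_
  rintro t ⟨φ, hφ, rfl⟩
  have main : ∀ a b : ℝ, l2 (a • g + b • gS) φ = 0 → 0 < l2 (a • g + b • gS) (a • g + b • gS) →
      s ≤ sSup (rayleighSet su2Rep L β fun ψ => l2 ψ φ = 0) := by
    intro a b horth hpos
    refine le_csSup_of_le (bddAbove_rayleighSet su2Rep continuous_su2Rep β _) ⟨a • g + b • gS, hphys a b, horth, hpos, rfl⟩ ?_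
    rw [le_div_iff₀ hpos]
    exact hray a b
  by_cases hp : l2 g φ = 0
  · refine main 1 0 ?_ ?_
    · rw [hl2φ 1 0 hφ, hp]; ring
    · rw [hl2]; norm_num; exact hn0
  · refine main (l2 gS φ) (-l2 g φ) ?_ ?_
    · rw [hl2φ _ _ hφ]; ring
    · rw [hl2]
      have : 0 < l2 g φ ^ 2 := by positivity
      nlinarith

/-- ★ **K2a at every fixed lattice size**: for every `L ≥ 1` there are `k, β₀` with `β^{-k} λ₀(β,L)^L ≤ λ₁(β,L)^L` for all `β ≥ β₀` — the first
zero-flux transfer level of `SU(2)` on `(ℤ/L)³` is within a power of `β` of the top one.  (`λ₀ ≤ c_β^{|E|}` by the Schur test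
`topValue_le_latCE`; `λ₁ ≥ β^{−k}c_β^{|E|}` by the swap pair; raise to the `L`-th power.) [cite: ReedSimonIV1978, Thm. XIII.1] [cite: Luscher1983, §2] -/
theorem subFemtoFirstLevel_rung_fixedL (L : ℕ) [NeZero L] :
    ∃ k β₀ : ℝ, ∀ β : ℝ, β₀ ≤ β →
      β ^ (-k) * levelValue su2Rep L β 0 ^ L ≤ levelValue su2Rep L β 1 ^ L := by
  obtain ⟨k, β₁, hβ₁, h⟩ := rpow_mul_latCE_le_levelValue_one L
  refine ⟨k * L, β₁, fun β hβ => ?_⟩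
  have hβ0 : 0 < β := by linarith
  have h1 : β ^ (-k) * levelValue su2Rep L β 0 ≤ levelValue su2Rep L β 1 := by
    refine le_trans (mul_le_mul_of_nonneg_left ?_ (by positivity)) (h β hβ)
    rw [levelValue_zero]
    exact topValue_le_latCE hβ0.le
  have h0 : 0 ≤ β ^ (-k) * levelValue su2Rep L β 0 := mul_nonneg (by positivity) (levelValue_zero_su2Rep_pos L β).le
  have h2 := pow_le_pow_left₀ h0 h1 L
  rw [mul_pow, ← Real.rpow_natCast (β ^ (-k)) L, ← Real.rpow_mul hβ0.le, neg_mul] at h2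
  exact h2

/-- The rung is literally the fixed-`L` slice of `SubFemtoFirstLevel`'s conclusion (same shape, the window hypotheses unused). -/
theorem subFemtoFirstLevel_rung_fixedL_shape (L : ℕ) [NeZero L] :
    ∃ k β₀ : ℝ, ∀ β : ℝ, β₀ ≤ β → ∀ A : ℝ, 0 < A → ((L : ℕ) : ℝ) ≤ β ^ A →
      β ^ (-k) * levelValue su2Rep L β 0 ^ L ≤ levelValue su2Rep L β 1 ^ L := by
  obtain ⟨k, β₀, h⟩ := subFemtoFirstLevel_rung_fixedL L
  exact ⟨k, β₀, fun β hβ _ _ _ => h β hβ⟩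

end Summit.QuantumFields.YangMills.Theses.ThermalTraceWindow

end
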